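import Mathlib

/-!
# STUB-IDEAS k1 companion — `stub_altFixing_orbit_dichotomy` (G2) of crux `MonotoneRestorationQP`
(item stmt-ValiantsHypothesis-15886, line `Sketch`; stub-ideation cell 1, FAMILY 1 — recognise & import).

Kernel-checked form of the plan `STUB-IDEAS-stub_altFixing_orbit_dichotomy-1.md` (same directory):
G2 = orbit–stabiliser inside `Alt(Ω)`, `Ω = Fin n ∖ X`, plus Dixon–Mortimer *Permutation Groups*
Thm 5.2A(i) ("a subgroup of `Alt(m)`, `m ≥ 5`, of index `< m` is `Alt(m)`"; = Alperin–Bell GTM 162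
§3 Ex. 1 applied to the simple group `Alt(m)`), imported from Mathlib's simplicity theorem
`alternatingGroup.normal_subgroup_eq_bot_or_eq_top` and the Poincaré step `|G| ∣ [G:H]!` for a
core-free `H` (the pattern inside `Subgroup.normal_of_index_eq_minFac_card`).  Helper lemmas
L1a/L1/L2/L2'/L3a/L3b/L4 and the assembly `stub_altFixing_orbit_dichotomy` (verbatim registered
signature) all elaborate: rc 0, no `sorry`, axioms ⊆ {propext, Classical.choice, Quot.sound}.
(The stub itself was landed independently by a stub-worker as p141690 while this cell ran; this
file is the second, self-contained `import Mathlib`-only proof and is NOT proposed to Theorems by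
the planner seat.)
-/

set_option linter.dupNamespace false

open Equiv Equiv.Perm

namespace Summit.ValiantsHypothesis.ValiantsHypothesis.Cruxes.MonotoneRestorationQP.StubIdeasAltFixing1

/-- L1a (Poincaré): trivial normal core ⇒ `|G| ∣ [G:H]!`. -/
theorem card_dvd_factorial_index_of_normalCore_eq_bot {G : Type*} [Group G] [Finite G]
    (H : Subgroup G) (h : H.normalCore = ⊥) : Nat.card G ∣ (H.index).factorial := by
  have : H.normalCore.index ∣ H.index.factorial := by
    rw [Subgroup.normalCore_eq_ker, Subgroup.index_ker, Subgroup.index_eq_card, ← Nat.card_perm]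
    exact Subgroup.card_subgroup_dvd_card _
  rwa [h, Subgroup.index_bot] at this

/-- L1 (Dixon–Mortimer 5.2A(i), alternating case): a subgroup of `Alt(α)` of index `< |α|`
is everything (`|α| ≥ 5`). -/
theorem alternatingGroup_subgroup_eq_top_of_index_lt {α : Type*} [Fintype α] [DecidableEq α]
    (h5 : 5 ≤ Fintype.card α) (H : Subgroup (alternatingGroup α))
    (hH : H.index < Fintype.card α) : H = ⊤ := by
  have hα : 5 ≤ Nat.card α := by rwa [Nat.card_eq_fintype_card]
  rcases alternatingGroup.normal_subgroup_eq_bot_or_eq_top hα (N := H.normalCore) with hbot | htop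
  · exfalso
    have hdvd : Nat.card (alternatingGroup α) ∣ H.index.factorial :=
      card_dvd_factorial_index_of_normalCore_eq_bot H hbot
    haveI : Nontrivial α := by
      rw [← Fintype.one_lt_card_iff_nontrivial]; omega
    have h2 : 2 * Nat.card (alternatingGroup α) = (Fintype.card α).factorial := by
      rw [two_mul_nat_card_alternatingGroup, Nat.card_perm, Nat.card_eq_fintype_card]
    have hidx1 : 1 ≤ H.index := Nat.one_le_iff_ne_zero.2 Subgroup.index_ne_zero_of_finite
    have hle : Nat.card (alternatingGroup α) ≤ (Fintype.card α - 1).factorial :=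
      (Nat.le_of_dvd (Nat.factorial_pos _) hdvd).trans (Nat.factorial_le (by omega))
    obtain ⟨m, hm⟩ : ∃ m, Fintype.card α = m + 1 := ⟨Fintype.card α - 1, by omega⟩
    rw [hm, Nat.factorial_succ] at h2
    rw [hm, Nat.add_sub_cancel] at hle
    have hpos : 0 < m.factorial := Nat.factorial_pos m
    have h3 : (m + 1) * m.factorial ≤ 2 * m.factorial := by rw [← h2]; omega
    have := Nat.le_of_mul_le_mul_right h3 hpos
    omega
  · exact top_le_iff.mp (htop.symm.trans_le (Subgroup.normalCore_le H))

/-- L2: composition law of the diagonal renaming (the action axiom). -/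
theorem rename_diag_mul {n : ℕ} {K : Type} [CommSemiring K] (σ τ : Perm (Fin n))
    (q : MvPolynomial (Fin n × Fin n) K) :
    MvPolynomial.rename (fun p : Fin n × Fin n => ((σ * τ) p.1, (σ * τ) p.2)) q =
      MvPolynomial.rename (fun p : Fin n × Fin n => (σ p.1, σ p.2))
        (MvPolynomial.rename (fun p : Fin n × Fin n => (τ p.1, τ p.2)) q) := by
  rw [MvPolynomial.rename_rename]; rfl

/-- L2': unit law. -/
theorem rename_diag_one {n : ℕ} {K : Type} [CommSemiring K] (q : MvPolynomial (Fin n × Fin n) K) :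
    MvPolynomial.rename (fun p : Fin n × Fin n => ((1 : Perm (Fin n)) p.1, (1 : Perm (Fin n)) p.2)) q
      = q := by
  have h : (fun p : Fin n × Fin n => ((1 : Perm (Fin n)) p.1, (1 : Perm (Fin n)) p.2)) = id := by
    funext p; simp
  rw [h, MvPolynomial.rename_id, AlgHom.id_apply]

/-- L3a: the identity extension of an even permutation of `Ω = Fin n ∖ X` fixes `X` and is even. -/
theorem ofSubtype_fix_and_sign {n : ℕ} (X : Finset (Fin n))
    (a : alternatingGroup {x : Fin n // x ∉ X}) :
    (∀ x ∈ X, Perm.ofSubtype (a : Perm {x : Fin n // x ∉ X}) x = x) ∧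
      Perm.sign (Perm.ofSubtype (a : Perm {x : Fin n // x ∉ X})) = 1 := by
  refine ⟨fun x hx => Perm.ofSubtype_apply_of_not_mem _ (by simpa using hx), ?_⟩
  rw [Perm.sign_ofSubtype]
  exact Equiv.Perm.mem_alternatingGroup.1 a.2

/-- L3b: every even permutation fixing `X` pointwise is such an extension. -/
theorem exists_ofSubtype_eq {n : ℕ} (X : Finset (Fin n)) (ρ : Perm (Fin n))
    (hρ : ∀ x ∈ X, ρ x = x) (hsign : Perm.sign ρ = 1) :
    ∃ a : alternatingGroup {x : Fin n // x ∉ X},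
      Perm.ofSubtype (a : Perm {x : Fin n // x ∉ X}) = ρ := by
  have hρp : ∀ x, ρ x ∉ X ↔ x ∉ X := by
    intro x
    by_cases hx : x ∈ X
    · rw [hρ x hx]
    · simp only [hx, not_false_eq_true, iff_true]
      intro hρx
      have h1 : ρ (ρ x) = ρ x := hρ (ρ x) hρx
      rw [ρ.apply_eq_iff_eq] at h1
      rw [h1] at hρx
      exact hx hρx
  have h2 : ∀ x, ρ x ≠ x → x ∉ X := fun x hx hxX => hx (hρ x hxX)
  refine ⟨⟨ρ.subtypePerm hρp, ?_⟩, ?_⟩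
  · rw [Equiv.Perm.mem_alternatingGroup, Equiv.Perm.sign_subtypePerm ρ hρp h2, hsign]
  · exact Equiv.Perm.ofSubtype_subtypePerm hρp h2

/-- L4: orbit–stabiliser counting, injection form (pattern of the landed
`gateSupport_index_le_card`): cosets of the stabiliser inject into `T`. -/
theorem index_le_card_of_orbit_subset {n : ℕ} {K : Type} [CommSemiring K]
    (q : MvPolynomial (Fin n × Fin n) K) (X : Finset (Fin n))
    (T : Finset (MvPolynomial (Fin n × Fin n) K))
    (horb : ∀ ρ : Perm (Fin n), (∀ x ∈ X, ρ x = x) → Perm.sign ρ = 1 →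
      MvPolynomial.rename (fun p : Fin n × Fin n => (ρ p.1, ρ p.2)) q ∈ T)
    (H : Subgroup (alternatingGroup {x : Fin n // x ∉ X}))
    (hH : ∀ a : alternatingGroup {x : Fin n // x ∉ X}, a ∈ H ↔ MvPolynomial.rename
      (fun p : Fin n × Fin n => (Perm.ofSubtype (a : Perm {x : Fin n // x ∉ X}) p.1,
        Perm.ofSubtype (a : Perm {x : Fin n // x ∉ X}) p.2)) q = q) :
    H.index ≤ T.card := by
  classical
  let act : alternatingGroup {x : Fin n // x ∉ X} → MvPolynomial (Fin n × Fin n) K := fun a =>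
    MvPolynomial.rename
      (fun p : Fin n × Fin n => (Perm.ofSubtype (a : Perm {x : Fin n // x ∉ X}) p.1,
        Perm.ofSubtype (a : Perm {x : Fin n // x ∉ X}) p.2)) q
  have hmem : ∀ a, act a ∈ T := fun a =>
    horb _ (ofSubtype_fix_and_sign X a).1 (ofSubtype_fix_and_sign X a).2
  let f : alternatingGroup {x : Fin n // x ∉ X} ⧸ H → T := fun c => ⟨act c.out, hmem c.out⟩
  have hf : Function.Injective f := by
    intro c d hcd
    have hcd' : act c.out = act d.out := congrArg Subtype.val hcd
    rw [← QuotientGroup.out_eq' c, ← QuotientGroup.out_eq' d, QuotientGroup.eq, hH,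
      Subgroup.coe_mul, InvMemClass.coe_inv, map_mul, map_inv, rename_diag_mul]
    change MvPolynomial.rename _ (act d.out) = q
    rw [← hcd']
    change MvPolynomial.rename _ (MvPolynomial.rename _ q) = q
    rw [← rename_diag_mul, inv_mul_cancel, rename_diag_one]
  calc H.index = Nat.card (alternatingGroup {x : Fin n // x ∉ X} ⧸ H) := rfl
    _ ≤ Nat.card T := Nat.card_le_card_of_injective f hf
    _ = T.card := by rw [Nat.card_eq_fintype_card, Fintype.card_coe]

/-- ASSEMBLY: the stub, verbatim signature, from L1–L4. -/
theorem stub_altFixing_orbit_dichotomy {n : ℕ} {K : Type} [CommSemiring K] (q : MvPolynomial (Fin n × Fin n) K) (X : Finset (Fin n)) (h8 : X.card + 9 ≤ n) (T : Finset (MvPolynomial (Fin n × Fin n) K)) (hT : T.card + X.card < n) (horb : ∀ ρ : Equiv.Perm (Fin n), (∀ x ∈ X, ρ x = x) → Equiv.Perm.sign ρ = 1 → MvPolynomial.rename (fun p : Fin n × Fin n => (ρ p.1, ρ p.2)) q ∈ T) : ∀ ρ : Equiv.Perm (Fin n), (∀ x ∈ X, ρ x = x) → Equiv.Perm.sign ρ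 = 1 → MvPolynomial.rename (fun p : Fin n × Fin n => (ρ p.1, ρ p.2)) q = q := by
  classical
  -- the stabiliser of `q` in `Alt(Ω)`, `Ω = Fin n ∖ X`, acting through `ofSubtype` and the diagonal renaming
  let H : Subgroup (alternatingGroup {x : Fin n // x ∉ X}) :=
    { carrier := {a | MvPolynomial.rename
        (fun p : Fin n × Fin n => (Perm.ofSubtype (a : Perm {x : Fin n // x ∉ X}) p.1,
          Perm.ofSubtype (a : Perm {x : Fin n // x ∉ X}) p.2)) q = q}
      mul_mem' := by
        intro a b ha hb
        simp only [Set.mem_setOf_eq] at ha hb ⊢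
        rw [Subgroup.coe_mul, map_mul, rename_diag_mul, hb, ha]
      one_mem' := by
        simp only [Set.mem_setOf_eq, OneMemClass.coe_one, map_one]
        exact rename_diag_one q
      inv_mem' := by
        intro a ha
        simp only [Set.mem_setOf_eq] at ha ⊢
        conv_lhs => rw [← ha]
        rw [InvMemClass.coe_inv, map_inv, ← rename_diag_mul, inv_mul_cancel, rename_diag_one] }
  have hHmem : ∀ a, a ∈ H ↔ MvPolynomial.rename
      (fun p : Fin n × Fin n => (Perm.ofSubtype (a : Perm {x : Fin n // x ∉ X}) p.1,
        Perm.ofSubtype (a : Perm {x : Fin n // x ∉ X}) p.2)) q = q := fun a => Iff.rfl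
  have hidx : H.index ≤ T.card := index_le_card_of_orbit_subset q X T horb H hHmem
  have hcardΩ : Fintype.card {x : Fin n // x ∉ X} = n - X.card := by
    rw [Fintype.card_subtype_compl, Fintype.card_coe, Fintype.card_fin]
  have htop : H = ⊤ :=
    alternatingGroup_subgroup_eq_top_of_index_lt (by omega) H (by omega)
  intro ρ hρ hsign
  obtain ⟨a, ha⟩ := exists_ofSubtype_eq X ρ hρ hsign
  have haH : a ∈ H := by rw [htop]; exact Subgroup.mem_top a
  rw [hHmem, ha] at haH
  exact haH

end Summit.ValiantsHypothesis.ValiantsHypothesis.Cruxes.MonotoneRestorationQP.StubIdeasAltFixing1
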